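import Summits.CriticalPhenomena.PercolationContinuityZ3.Theorems.Transplant.SkelFrmBParamsCorrKGLen3
import HarnessLib

/-!
# N2 (frames-only node `SamePDropOfSkeletonFrm₁`, OPEN) — (ζ″) under J23/(R-44) and (R-46): THE y′-CORRIDOR BUDGET WITH SLACK, `N + 1 + (m₁+1) + (m₂+1) + 64 ≤ LfQ`
# under `KGResY3` (caps `100·n_L`) — p3-g17's ask 12:17:36Z (2): the (R) root's y′-corridor re-uses the (C) values `(q_Y, W_Y, kgNYv0)` and spends
# `1 + (27 + 2 + 8) + 1` extra steps (bridge + x-prefix at `Nx = 26`); the generic bound is `≈ 57.75K + 745 + 64 ≤ 80K` for `K ≥ 40`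

* `KGYRows.kgSchedNY_budget3_slack` (generic, `W ≤ 102n`), **`kgSchedNY_le_LfQ3_slack`** (values).
NON-VACUITY: pure budget rows (`EqNumL`, `gFloorKG ≤ g`, `KGResY3`).
builds on p205010 (kernel theorem, internal audit signed; external expert review pending) — nothing in this file uses p205010; NOTHING is claimed about the
open node `SamePDropOfSkeletonFrm₁`.
Lane `prim-bschramm`, seat `prim-bschramm-stmt` (gen 21); helper file (`--supports stmt-CriticalPhenomena-4575 --as helper`).
[cite: KozmaNitzan2024, §4 Lemma 12 (pp. 23–25), p. 26 (29)] [cite: MartineauTassion2017, §4.3 Lemma 4.2]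
-/

open scoped Classical

noncomputable section

namespace Summit.CriticalPhenomena.PercolationContinuityZ3.Theorems.Transplant

namespace Skelφ

open Literature.Probability.Percolation Literature.Probability.LatticeModels SimpleGraph

section Budget3S

variable {n ℓ : ℕ} {hs v : ℤ} {R' ρ q W : ℕ}

/-- **THE LENGTH BUDGET WITH SLACK, generic, second axis, at `W ≤ 102n`**: `N + 1 + (m₁+1) + (m₂+1) + 64 ≤ 80·K` (`K ≥ 40`, `N ≤ 21K + 2`). [this work] -/
theorem KGYRows.kgSchedNY_budget3_slack (H : KGYRows n ℓ hs v R' ρ q W) (hSn : 3 * (2 * (R' : ℤ) + ρ) ≤ n) (hS : 3 * (2 * (R' : ℤ) + ρ) ≤ kgSLY n ℓ hs)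
    (hR8 : 8 * (R' : ℤ) ≤ n) (hW : (W : ℤ) ≤ 102 * n) (hq : (q : ℤ) ≤ 41 * kgSLY n ℓ hs + 2) (hρP : (ρ : ℤ) ≤ (n * ℓ / shearUnit n hs : ℕ) + 2)
    (hbig : 958 ≤ kgSLY n ℓ hs) {K : ℤ} (hK : 40 ≤ K) (N : ℕ) (hNK : (N : ℤ) ≤ 21 * K + 2) :
    (N : ℤ) + 1 + ((((kgM₁Y n v R' ρ W N : ℕ) : ℤ)) + 1) + ((((kgM₂Y n ℓ hs v R' ρ q W N : ℕ) : ℤ)) + 1) + 64 ≤ 80 * K := by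
  have f1 := H.kgM₁Y_succ_budget3 hSn hW hR8 N
  have f2 := H.kgM₂Y_succ_budget hS hρP N
  have hR0 : (0 : ℤ) ≤ R' := by positivity
  have hρ0 : (0 : ℤ) ≤ ρ := by positivity
  have hdS : ((dS n ℓ hs : ℕ) : ℤ) ≤ 2 := by exact_mod_cast dS_le_two n ℓ hs
  have hdS0 : (0 : ℤ) ≤ ((dS n ℓ hs : ℕ) : ℤ) := by positivity
  set a := (((kgM₁Y n v R' ρ W N : ℕ) : ℤ)) + 1 with ha_def
  set b := (((kgM₂Y n ℓ hs v R' ρ q W N : ℕ) : ℤ)) + 1 with hb_def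
  set s := kgSLY n ℓ hs with hs_def
  have ha0 : 0 ≤ a := by positivity
  have hb0 : 0 ≤ b := by positivity
  have hN0 : (0 : ℤ) ≤ (N : ℤ) + 1 := by positivity
  have hT : kgTY n ℓ hs v R' ρ q W N = 2 * (q : ℤ) + 2 * (((N : ℤ) + 1) * R') + ((N : ℤ) + 1) * (dS n ℓ hs : ℕ) + 2 * (a * ((R' : ℤ) + ρ)) := by
    unfold kgTY; ring
  have g1 : 3 * (a * ((R' : ℤ) + ρ)) ≤ a * s := by nlinarith
  have g2 : 6 * (((N : ℤ) + 1) * R') ≤ ((N : ℤ) + 1) * s := by nlinarith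
  have g3 : 3 * (((N : ℤ) + 1) * (dS n ℓ hs : ℕ)) ≤ ((N : ℤ) + 1) * s := by nlinarith
  have g5 : 2 * s * b ≤ (247 + 2 * ((N : ℤ) + 1) + 2 * a) * s := by rw [hT] at f2; nlinarith
  have g6 : 2 * b ≤ 247 + 2 * ((N : ℤ) + 1) + 2 * a := by
    have : s * (2 * b) ≤ s * (247 + 2 * ((N : ℤ) + 1) + 2 * a) := by nlinarith
    exact le_of_mul_le_mul_left this (by linarith)
  linarith

end Budget3S

end Skelφ

/-! ## At the values of record (`ρ := 0`): the successor residual floors and the two budgets -/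

namespace PlanarSkeletonFrm

namespace NegB

open Literature.Probability.Percolation Literature.Probability.LatticeModels SimpleGraph
open SkelConc (Consts)
open Skelφ (shearUnit kgSL kgSLY kgM₁ kgM₂ kgM₁Y kgM₂Y KGRows KGYRows)
open Neg

section Values3S

variable (κ : Consts) {V : Type} [DecidableEq V] [Countable V] {G : SimpleGraph V} [G.LocallyFinite] (Φ : PlanarSkeletonFrm G) (t : V) (p : unitInterval)
  (D : Skelφ.StepI.DataNS V) (g f mk qx Wx : ℕ)

/-- **THE N-CORRIDOR FITS THE BUDGET WITH 64 STEPS TO SPARE** (`ρ := 0`, `KGResY3`): `N + 1 + (m₁+1) + (m₂+1) + 64 ≤ LfQ κ.K₀` — p3-g17's (R-46) root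
y′-corridor spends `1 + (27 + 2 + 8) + 1 ≤ 64` extra steps on bridge + x-prefix. [this work] -/
theorem kgSchedNY_le_LfQ3_slack (hN : EqNumL κ Φ t p D g f) (hg : gFloorKG κ Φ t p D mk ≤ g) (hx : KGResY3 κ Φ t p D g f qx Wx) :
    kgNYv0 κ Φ t p D g f mk qx Wx + 1 +
        (kgM₁Y (nL κ Φ t p D g f) (vL κ Φ t p D g f) (kgR κ Φ t p D mk) 0 (kgWY κ Φ t p D g f Wx) (kgNYv0 κ Φ t p D g f mk qx Wx) + 1) +
        (kgM₂Y (nL κ Φ t p D g f) (ℓL κ Φ t p D g f) (hL κ Φ t p D g f) (vL κ Φ t p D g f) (kgR κ Φ t p D mk) 0 (kgqY κ Φ t p D g f qx)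
          (kgWY κ Φ t p D g f Wx) (kgNYv0 κ Φ t p D g f mk qx Wx) + 1) + 64 ≤ LfQ κ.K₀ := by
  have H := kgYRows0_of κ Φ t p D g f mk qx Wx hN hg
  obtain ⟨hSn, hS, hR8, hbig, hρP⟩ := kgY_floors κ Φ t p D g f mk hN hg
  have hNle := kgNYv0_le κ Φ t p D g f mk qx Wx hN hg
  have hK := (Skelφ.NegPrm.forty_le_Kcell κ.K₀).1
  have hK' : (40 : ℤ) ≤ (Neg.K κ : ℤ) := by unfold Neg.K; exact_mod_cast hK
  have hNz : ((kgNYv0 κ Φ t p D g f mk qx Wx : ℕ) : ℤ) ≤ 21 * (Neg.K κ : ℤ) + 2 := by exact_mod_cast hNle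
  have hW : ((kgWY κ Φ t p D g f Wx : ℕ) : ℤ) ≤ 102 * (nL κ Φ t p D g f : ℤ) := by
    have hWx : Wx ≤ 100 * nL κ Φ t p D g f := hx.hWx
    unfold kgWY; push_cast
    have : ((Wx : ℕ) : ℤ) ≤ 100 * (nL κ Φ t p D g f : ℤ) := by exact_mod_cast hWx
    linarith
  have hq : ((kgqY κ Φ t p D g f qx : ℕ) : ℤ) ≤ 41 * kgSLY (nL κ Φ t p D g f) (ℓL κ Φ t p D g f) (hL κ Φ t p D g f) + 2 := by
    have hqx := hx.hqx
    have hPd := Skelφ.natDiv_le_kgSLY (one_le_of_eqNumL κ Φ t p D g f hN).1 (ℓL κ Φ t p D g f) (hL κ Φ t p D g f)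
    unfold kgqY
    push_cast [Nat.cast_add] at hPd ⊢
    linarith
  have hb := H.kgSchedNY_budget3_slack hSn hS hR8 hW hq hρP hbig hK' (kgNYv0 κ Φ t p D g f mk qx Wx) hNz
  have hZ : ((kgNYv0 κ Φ t p D g f mk qx Wx + 1 +
        (kgM₁Y (nL κ Φ t p D g f) (vL κ Φ t p D g f) (kgR κ Φ t p D mk) 0 (kgWY κ Φ t p D g f Wx) (kgNYv0 κ Φ t p D g f mk qx Wx) + 1) +
        (kgM₂Y (nL κ Φ t p D g f) (ℓL κ Φ t p D g f) (hL κ Φ t p D g f) (vL κ Φ t p D g f) (kgR κ Φ t p D mk) 0 (kgqY κ Φ t p D g f qx)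
          (kgWY κ Φ t p D g f Wx) (kgNYv0 κ Φ t p D g f mk qx Wx) + 1 + 64) : ℕ) : ℤ) ≤ ((LfQ κ.K₀ : ℕ) : ℤ) := by
    rw [LfQ_eq]; push_cast; linarith
  exact_mod_cast hZ

end Values3S

end NegB

end PlanarSkeletonFrm

end Summit.CriticalPhenomena.PercolationContinuityZ3.Theorems.Transplant

end
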